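import Summits.CriticalPhenomena.SAWScalingLimit.Theses.SAWRenewalTightness
import Summits.CriticalPhenomena.SAWScalingLimit.Theorems.AnnularMassDecay.Negative.LoadBearing

/-!
# Line `radial-renewal-kesten-inequality` for the crux `SAWRenewalTightness.AnnularMassDecay` (stmt-CriticalPhenomena-4729)

Planner skeleton (crux-plan, round 1; idea `Ideas/radial-renewal-kesten-inequality.md`, triage r1-1/2/3: pass with
sharpenings; Disproof.lean cycle 2 read, incl. §H).  Line card: `Lines/radial-renewal-kesten-inequality.md`.

THE LEVER (idea card, kept verbatim): the RADIAL RENEWAL TIMES of a walk `ω` from `u` towards the centre `z` — times `t`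
whose circle `{|· - z| = |ω_t - z|}` strictly separates the past (outside) from the future (inside).  Because the
future after such a `t` is confined to the open disc `D_{|ω_t - z|}(z)` about the SAME centre, cutting at a renewal
time is an exact bijection and the crux's masses obey an exact Markov-renewal structure over concentric circles.

THE RESHAPING (what the triage panel asked for, and what Disproof §H forces).  All three triagers certified the `θ = 0`
half (`RKI ⟹ AnnularMassBounded`, `C = 1`) and all three showed that the card's `θ > 0` transfer `RadialSeedToDecay`
does NOT follow: the first-renewal recursion is valid for the CHAIN-STOPPED mass (walks stopped at their first renewal
below a level; triage r1-1 `H`, r1-2 `F`, r1-3 `D_≤`), not for the crux's first-entrance mass `M`.  They asked to retype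
the seed as a chain statement (`ChainSeed` / `DeathSeed := ∃ A>1, ε>0, D_{≤|u-z|/A}(u) ≤ 1-ε`) and to restrict the skip
tail.  Meanwhile the standing disprover (Disproof.lean §H, PERM, 10σ) found the card's pointwise RADIAL KESTEN
INEQUALITY `k(u) ≤ 1` NUMERICALLY FALSE for generic (non-lattice) centres at `R ≈ 8` (`k = 1.0082 ± 0.0008` at
`z = (0.01,-0.003)`, `u = (8,1)`; lattice-centred `0.946`).  So pointwise RKI cannot be a stub.  This skeleton keeps the
lever and replaces RKI by the weaker statement the line actually consumes — BOUNDEDNESS of the chain-stopped mass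
(`stub_chainBounded`, `K₀` instead of `1`; not contradicted by `k ≈ 1.01`) — and takes `θ > 0` from the triage's
`DeathSeed` plus a restricted skip tail, through the exact first-`A`-descent factorisation and a renewal-inequality
induction that manufactures the power law.  The chain-stopped family at level `s` from `u` (centre `z`, `ρ_u = |u-z|`):
self-avoiding `ω` from `u`, `n > 0` steps, confined to the open disc `D_{ρ_u}(z)` after time `0`, whose END is a strict
radial record with `|ω_n - z| ≤ s`, and none of whose radial renewal times `0 < t < n` has `|ω_t - z| ≤ s` ("the first
renewal-or-end at level `≤ s` is the end").  Its `x_c`-mass up to length `N` is written `D(u;s)[N]` below (always spelled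
out over tree vocabulary: `SAW.Zd.saws`, `SAW.criticalFugacity`, `Site.toComplex`; no local definition enters a stub).
The crux's annular bridges from `u` with `R ≤ ρ_u` are members at level `r` (proved in `AnnularMassDecay_of`).

THE STUBS (5; sorries live only in them):
* S1 `stub_chainBounded` (OPEN; the θ = 0 atom, "G_{z_c} finite"-strength, Disproof §E/§F(v)): `D(u;s)[N] ≤ K₀` for all
  `z, u, s ≥ 1, N`.  RKI would give it with `K₀ = 1`; numerically `sup_s D(u;s) = k(u) ≤ 1.06` in every scan
  (triage r1-1 `rki_enum_H.c`: `sup_r H = k` exactly; Disproof §H at `R ≈ 8`: `k = 1.008(1)` strict, `≤ 1.06` for the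
  ties-included proxy).
* S2 `stub_deathSeed` (OPEN; HARDEST — the contraction that carries θ > 0; = triage r1-3 `DeathSeed`, r1-2 `ChainSeed`):
  `∃ A > 1, ε > 0` with `D(u; ρ_u/A)[N] ≤ 1 - ε` for all `z, u, N`.  SLE₈/₃ scaling predicts chain survival per
  `A`-fold `≍ A^{-35/48}`; exact data `D(u;ρ_u/2) = 0.43–0.51` (r1-3), lattice-scale floor `≈ x_c` (hence `A` free).
* S3 `stub_skipTail` (OPEN; one-arm/targeting estimate for ONE radially irreducible piece): for every `A > 1` there are
  `κ > 0, C` with: the members of the level-`ρ_u/A` family whose end lies at level `≤ ρ_u/(AB)` have mass `≤ C B^{-κ}`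
  whenever `1 ≤ B` and `A·B ≤ ρ_u` (landing level `≥ 1`: below the lattice scale the ratio is meaningless — a centre `z`
  at distance `10⁻⁹` from a lattice point would otherwise give mass `x_c` at unbounded `B`; this is the card's
  `RadialSkipTail` restricted as r1-1 demanded, and per A-descent as r1-2 suggested).  Data: `0.13–0.32` at `B = 2`,
  `0.03–0.05` at `B = 4`, scale-free-looking (r1-1).
* S4 `stub_firstDescentFactorisation` (PROVABLE NOW, M; the lever as a theorem): for `s < ρ_u/A`, cutting a member of the
  level-`s` family at its first renewal-or-end time `t*` with `|ω_{t*} - z| ≤ ρ_u/A` is injective into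
  (level-`ρ_u/A` member `η` from `u` with end `w = u + η_m`, `|w-z| > s`) × (level-`s` member from `w`, confined to
  `D_{|w-z|}(z)`), or `t* = n` (a level-`ρ_u/A` member ending at level `≤ s`): hence
  `D(u;s)[N] ≤ Σ_η x_c^{|η|} D(u+η_m; s)[N] + Skip(u; A, s)[N]`.  Same split as `SAW.Zd.count_add_le`, at the random time `t*`.
* S5 `stub_chainDecay` (PROVABLE NOW, M–L; pure analysis on S4's inequality): S4 → S1 → S2 → S3 → ChainDecay,
  `D(u;r)[N] ≤ C (r/ρ_u)^θ` for `1 ≤ r < ρ_u` — strong induction on the class `j` of `ρ_u/r` (`A^j < ρ_u/r ≤ A^{j+1}`),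
  a discrete renewal inequality `Φ_j ≤ Σ_i m_i Φ_{j-i(-1)} + C_s A^{κ(1-j)}` with `Σ m_i ≤ 1-ε` (S2), `m_i ≤ C_s A^{-κ i}` (S3),
  `Φ_0 ≤ K₀` (S1), closed by `Φ_j ≤ C λ^j` for `λ < 1` close to `1`; `θ = log_A(1/λ)`.
* `AnnularMassDecay_of` (PROVED here, no sorry): the crux family (interior in `r < |·-z| < R`, end in `|·-z| ≤ r`,
  `R ≤ ρ_u`) is contained in the level-`r` chain family, and `(r/ρ_u)^θ ≤ (r/R)^θ`; concludes
  `Summit.CriticalPhenomena.SAWScalingLimit.Theses.SAWRenewalTightness.AnnularMassDecay` BY NAME.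

DISPROOF USED (Disproof.lean cycles 1–2; landed `Theorems/AnnularMassDecay/Negative/LoadBearing` — imported above so
the scratch check sees it — and `Negative/HalfPlaneDivergence`, cycle 2, not yet built on the farm at planning time): `false_without_startOutside` — honoured in `AnnularMassDecay_of`
(`R ≤ ρ_u` is what makes the crux family a sub-family of the chain family of `u`'s OWN disc and gives `(r/ρ_u)^θ ≤ (r/R)^θ`);
`false_without_innerRadiusOne` — honoured by `1 ≤ r` in ChainDecay/S5, `1 ≤ s` in S1 and `A·B ≤ ρ_u` in S3 (the same
lattice-scale witnesses kill the unrestricted versions, see S3); `false_without_endInside` — every family here has the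
endpoint clause `|ω_n - z| ≤ level`; `false_without_avoidInner` / `halfPlanePartialSum_unbounded` (§A'') — the chain family
replaces "interior avoids the target disc" by "end = strict radial record and no renewal at level ≤ s before it", which
CONTAINS the crux family and excludes the hung half-plane walks of §A'' unless they end at a record with every earlier
record undone; the mass of those is exactly what S1 bounds (not assumed silently); `annularMassDecay_iff_posR` (§A':
`r < R` cosmetic) — consistent: ChainDecay only needs `r < ρ_u`; `const_ge_of_bound` (§B') — constants existential; §H —
answered above (no pointwise RKI anywhere in this file).  `ledger negatives --problem CriticalPhenomena`: nothing on
bridge / annular / renewal masses (stmt-0772 all-δ Tight and stmt-8261 untouched: everything here is at `x = x_c` on `ℤ²`).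
-/

noncomputable section

namespace Summit.CriticalPhenomena.SAWScalingLimit.Cruxes.AnnularMassDecay.RadialRenewalKestenInequality

open scoped BigOperators Classical
open Literature.Probability.LatticeModels Literature.Probability.RandomPlanarGeometry
open Summit.CriticalPhenomena.SAWScalingLimit.Theses.SAWRenewalTightness (AnnularMassDecay)
open Summit.CriticalPhenomena.SAWScalingLimit.Theorems.AnnularMassDecay.Negative (criticalFugacity_pos)

/-! ## The five stub STATEMENTS as named `Prop`s

(Readable handles only: the registered `stub_*` theorems below restate them VERBATIM over tree vocabulary, the
`*_holds` theorems certify the agreement definitionally, and `Registered.stub_*` are the name-keyed aliases used as the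
hypotheses of `AnnularMassDecay_of` — the skeleton audit admits a hypothesis by the last name component of its head;
same device as `Cruxes/…/Lines/inert-box-collapse.lean` on ABC.)  Throughout, for a start `u : Site 2`, a centre
`z : ℂ` and a level `s : ℝ`, the CHAIN-STOPPED FAMILY at level `s` consists of the `ω ∈ SAW.Zd.saws 2 n` with
`0 < n`; `|u + ω i - z| < |u - z|` for `0 < i ≤ n`; `|u + ω n - z| < |u + ω i - z|` for `i < n` (end = strict radial record);
`|u + ω n - z| ≤ s`; and, for every `0 < t < n` which is a RADIAL RENEWAL TIME (`|u+ω t-z| < |u+ω i-z|` for `i < t` and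
`|u+ω j-z| < |u+ω t-z|` for `t < j ≤ n`), `s < |u + ω t - z|`.  `D(u;s)[N]` = its `x_c`-mass over lengths `n ≤ N`. -/

/-- S1 statement — CHAIN BOUNDEDNESS (θ = 0 atom): `∃ K₀, D(u;s)[N] ≤ K₀` for all centres, starts, levels `s ≥ 1`, `N`. -/
def ChainBounded : Prop :=
  ∃ K₀ : ℝ, ∀ (z : ℂ) (u : Site 2) (s : ℝ), 1 ≤ s → ∀ N : ℕ,
      (∑ n ∈ Finset.range (N + 1),
        ∑ _ω ∈ (SAW.Zd.saws 2 n).filter (fun ω =>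
          0 < n ∧
          (∀ i, 0 < i → i ≤ n → dist (Site.toComplex (u + ω i)) z < dist (Site.toComplex u) z) ∧
          (∀ i, i < n → dist (Site.toComplex (u + ω n)) z < dist (Site.toComplex (u + ω i)) z) ∧
          dist (Site.toComplex (u + ω n)) z ≤ s ∧
          (∀ t, 0 < t → t < n →
            (∀ i, i < t → dist (Site.toComplex (u + ω t)) z < dist (Site.toComplex (u + ω i)) z) →
            (∀ j, t < j → j ≤ n → dist (Site.toComplex (u + ω j)) z < dist (Site.toComplex (u + ω t)) z) →
            s < dist (Site.toComplex (u + ω t)) z)),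
          SAW.criticalFugacity ^ n) ≤ K₀

/-- S2 statement — DEATH SEED (contraction at one ratio): `∃ A > 1, ε > 0, D(u; |u-z|/A)[N] ≤ 1 - ε`. -/
def DeathSeed : Prop :=
  ∃ A ε : ℝ, 1 < A ∧ 0 < ε ∧ ∀ (z : ℂ) (u : Site 2) (N : ℕ),
      (∑ n ∈ Finset.range (N + 1),
        ∑ _ω ∈ (SAW.Zd.saws 2 n).filter (fun ω =>
          0 < n ∧
          (∀ i, 0 < i → i ≤ n → dist (Site.toComplex (u + ω i)) z < dist (Site.toComplex u) z) ∧
          (∀ i, i < n → dist (Site.toComplex (u + ω n)) z < dist (Site.toComplex (u + ω i)) z) ∧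
          dist (Site.toComplex (u + ω n)) z ≤ dist (Site.toComplex u) z / A ∧
          (∀ t, 0 < t → t < n →
            (∀ i, i < t → dist (Site.toComplex (u + ω t)) z < dist (Site.toComplex (u + ω i)) z) →
            (∀ j, t < j → j ≤ n → dist (Site.toComplex (u + ω j)) z < dist (Site.toComplex (u + ω t)) z) →
            dist (Site.toComplex u) z / A < dist (Site.toComplex (u + ω t)) z)),
          SAW.criticalFugacity ^ n) ≤ 1 - ε

/-- S3 statement — SKIP TAIL of the first `A`-descent (landing level `≥ 1`): the level-`|u-z|/A` members ending at
level `≤ |u-z|/(AB)` have mass `≤ C B^{-κ}` (`1 ≤ B`, `A·B ≤ |u-z|`), for every `A > 1` with `κ, C` depending on `A`. -/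
def SkipTail : Prop :=
  ∀ A : ℝ, 1 < A → ∃ κ C : ℝ, 0 < κ ∧ ∀ B : ℝ, 1 ≤ B → ∀ (z : ℂ) (u : Site 2),
      A * B ≤ dist (Site.toComplex u) z → ∀ N : ℕ,
      (∑ n ∈ Finset.range (N + 1),
        ∑ _ω ∈ (SAW.Zd.saws 2 n).filter (fun ω =>
          dist (Site.toComplex (u + ω n)) z ≤ dist (Site.toComplex u) z / (A * B) ∧
          0 < n ∧
          (∀ i, 0 < i → i ≤ n → dist (Site.toComplex (u + ω i)) z < dist (Site.toComplex u) z) ∧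
          (∀ i, i < n → dist (Site.toComplex (u + ω n)) z < dist (Site.toComplex (u + ω i)) z) ∧
          dist (Site.toComplex (u + ω n)) z ≤ dist (Site.toComplex u) z / A ∧
          (∀ t, 0 < t → t < n →
            (∀ i, i < t → dist (Site.toComplex (u + ω t)) z < dist (Site.toComplex (u + ω i)) z) →
            (∀ j, t < j → j ≤ n → dist (Site.toComplex (u + ω j)) z < dist (Site.toComplex (u + ω t)) z) →
            dist (Site.toComplex u) z / A < dist (Site.toComplex (u + ω t)) z)),
          SAW.criticalFugacity ^ n) ≤ C * B ^ (-κ)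

/-- S4 statement — FIRST-`A`-DESCENT FACTORISATION (exact renewal cut, as an inequality of partial sums). -/
def FirstDescentFactorisation : Prop :=
  ∀ A : ℝ, 1 < A → ∀ (z : ℂ) (u : Site 2) (s : ℝ), s < dist (Site.toComplex u) z / A → ∀ N : ℕ,
      (∑ n ∈ Finset.range (N + 1),
        ∑ _ω ∈ (SAW.Zd.saws 2 n).filter (fun ω =>
          0 < n ∧
          (∀ i, 0 < i → i ≤ n → dist (Site.toComplex (u + ω i)) z < dist (Site.toComplex u) z) ∧
          (∀ i, i < n → dist (Site.toComplex (u + ω n)) z < dist (Site.toComplex (u + ω i)) z) ∧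
          dist (Site.toComplex (u + ω n)) z ≤ s ∧
          (∀ t, 0 < t → t < n →
            (∀ i, i < t → dist (Site.toComplex (u + ω t)) z < dist (Site.toComplex (u + ω i)) z) →
            (∀ j, t < j → j ≤ n → dist (Site.toComplex (u + ω j)) z < dist (Site.toComplex (u + ω t)) z) →
            s < dist (Site.toComplex (u + ω t)) z)),
          SAW.criticalFugacity ^ n) ≤
      (∑ m ∈ Finset.range (N + 1),
        ∑ η ∈ (SAW.Zd.saws 2 m).filter (fun η =>
            s < dist (Site.toComplex (u + η m)) z ∧
            0 < m ∧
            (∀ i, 0 < i → i ≤ m → dist (Site.toComplex (u + η i)) z < dist (Site.toComplex u) z) ∧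
            (∀ i, i < m → dist (Site.toComplex (u + η m)) z < dist (Site.toComplex (u + η i)) z) ∧
            dist (Site.toComplex (u + η m)) z ≤ dist (Site.toComplex u) z / A ∧
            (∀ t, 0 < t → t < m →
              (∀ i, i < t → dist (Site.toComplex (u + η t)) z < dist (Site.toComplex (u + η i)) z) →
              (∀ j, t < j → j ≤ m → dist (Site.toComplex (u + η j)) z < dist (Site.toComplex (u + η t)) z) →
              dist (Site.toComplex u) z / A < dist (Site.toComplex (u + η t)) z)),
          SAW.criticalFugacity ^ m *
            (∑ n ∈ Finset.range (N + 1),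
                ∑ _ω ∈ (SAW.Zd.saws 2 n).filter (fun ω =>
                  0 < n ∧
                  (∀ i, 0 < i → i ≤ n → dist (Site.toComplex (u + η m + ω i)) z < dist (Site.toComplex (u + η m)) z) ∧
                  (∀ i, i < n → dist (Site.toComplex (u + η m + ω n)) z < dist (Site.toComplex (u + η m + ω i)) z) ∧
                  dist (Site.toComplex (u + η m + ω n)) z ≤ s ∧
                  (∀ t, 0 < t → t < n →
                    (∀ i, i < t → dist (Site.toComplex (u + η m + ω t)) z < dist (Site.toComplex (u + η m + ω i)) z) →
                    (∀ j, t < j → j ≤ n → dist (Site.toComplex (u + η m + ω j)) z < dist (Site.toComplex (u + η m + ω t)) z) →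
                    s < dist (Site.toComplex (u + η m + ω t)) z)),
                  SAW.criticalFugacity ^ n)) +
      (∑ n ∈ Finset.range (N + 1),
        ∑ _ω ∈ (SAW.Zd.saws 2 n).filter (fun ω =>
          dist (Site.toComplex (u + ω n)) z ≤ s ∧
          0 < n ∧
          (∀ i, 0 < i → i ≤ n → dist (Site.toComplex (u + ω i)) z < dist (Site.toComplex u) z) ∧
          (∀ i, i < n → dist (Site.toComplex (u + ω n)) z < dist (Site.toComplex (u + ω i)) z) ∧
          dist (Site.toComplex (u + ω n)) z ≤ dist (Site.toComplex u) z / A ∧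
          (∀ t, 0 < t → t < n →
            (∀ i, i < t → dist (Site.toComplex (u + ω t)) z < dist (Site.toComplex (u + ω i)) z) →
            (∀ j, t < j → j ≤ n → dist (Site.toComplex (u + ω j)) z < dist (Site.toComplex (u + ω t)) z) →
            dist (Site.toComplex u) z / A < dist (Site.toComplex (u + ω t)) z)),
          SAW.criticalFugacity ^ n)

/-- CHAIN DECAY — the strengthened crux `C⁺` this line transfers from: `D(u;r)[N] ≤ C (r/|u-z|)^θ` for `1 ≤ r < |u-z|`. -/
def ChainDecay : Prop :=
  ∃ θ C : ℝ, 0 < θ ∧ ∀ (z : ℂ) (u : Site 2) (r : ℝ), 1 ≤ r → r < dist (Site.toComplex u) z → ∀ N : ℕ,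
      (∑ n ∈ Finset.range (N + 1),
        ∑ _ω ∈ (SAW.Zd.saws 2 n).filter (fun ω =>
          0 < n ∧
          (∀ i, 0 < i → i ≤ n → dist (Site.toComplex (u + ω i)) z < dist (Site.toComplex u) z) ∧
          (∀ i, i < n → dist (Site.toComplex (u + ω n)) z < dist (Site.toComplex (u + ω i)) z) ∧
          dist (Site.toComplex (u + ω n)) z ≤ r ∧
          (∀ t, 0 < t → t < n →
            (∀ i, i < t → dist (Site.toComplex (u + ω t)) z < dist (Site.toComplex (u + ω i)) z) →
            (∀ j, t < j → j ≤ n → dist (Site.toComplex (u + ω j)) z < dist (Site.toComplex (u + ω t)) z) →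
            r < dist (Site.toComplex (u + ω t)) z)),
          SAW.criticalFugacity ^ n) ≤ C * (r / dist (Site.toComplex u) z) ^ θ

/-- S5 statement — the renewal-inequality induction: S4 → S1 → S2 → S3 → ChainDecay. -/
def ChainDecayReduction : Prop :=
  FirstDescentFactorisation → ChainBounded → DeathSeed → SkipTail → ChainDecay

/-! ## The registered stubs (`sorry` lives only in these five theorems) -/

/-- **S1 · `stub_chainBounded`** — CHAIN BOUNDEDNESS (OPEN; the θ = 0 atom; size XL as mathematics, the statement is
what the idea's RKI was FOR).  There is `K₀` such that for every centre `z ∈ ℂ`, start `u ∈ ℤ²`, level `s ≥ 1` and `N`,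
the `x_c`-mass `D(u;s)[N]` of the chain-stopped family (walks from `u` confined to the open disc `D_{|u-z|}(z)` after
time 0, ending at a strict radial record at level `≤ s`, with no radial renewal time at level `≤ s` before the end) is
`≤ K₀`.  Why plausibly true: cutting at ALL renewal times writes `D(u;s)` as the survival mass of the exact radial
renewal chain (kernel = radially irreducible descents, row sums `k(v)`); `sup_s D(u;s) = k(u)` in every exact scan and
`k ≤ 0.94` (≤ 47 sites, all centres; triage r1-1/r1-3), `k = 1.008(1)` at `R ≈ 8` generic centre (Disproof §H, PERM) —
bounded, near `1`; the linear shadow is Kesten's `Σ_irr x_c^{|β|} = A(x_c) = 1` (route support `KestenIdentity`,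
stmt-4733; MadrasSlade1993 (4.2.4)).  Pointwise `k ≤ 1` (the card's RKI) would give `K₀ = 1` by induction over the
finitely many radii below `|u-z|` (triage-certified) but is numerically false for generic centres (§H), hence NOT
assumed.  Why it might fail / why open: any uniform bound on a critical point-to-set `x_c`-mass on `ℤ²` is of
"`G_{z_c}(0,x) < ∞`" strength (MadrasSlade1993 p.77; Disproof §E); no technique in print (hexagonal lattice: parafermion).
Checked against the landed Negative lemmas: keeps the endpoint clause and `1 ≤ s`; the §A'' hung half-plane walks are
not members unless record-ending with all records undone. [MadrasSlade1993 §4.2; Kesten1963SAW; arXiv:1205.0401] -/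
theorem stub_chainBounded :
    ∃ K₀ : ℝ, ∀ (z : ℂ) (u : Site 2) (s : ℝ), 1 ≤ s → ∀ N : ℕ,
      (∑ n ∈ Finset.range (N + 1),
        ∑ _ω ∈ (SAW.Zd.saws 2 n).filter (fun ω =>
          0 < n ∧
          (∀ i, 0 < i → i ≤ n → dist (Site.toComplex (u + ω i)) z < dist (Site.toComplex u) z) ∧
          (∀ i, i < n → dist (Site.toComplex (u + ω n)) z < dist (Site.toComplex (u + ω i)) z) ∧
          dist (Site.toComplex (u + ω n)) z ≤ s ∧
          (∀ t, 0 < t → t < n →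
            (∀ i, i < t → dist (Site.toComplex (u + ω t)) z < dist (Site.toComplex (u + ω i)) z) →
            (∀ j, t < j → j ≤ n → dist (Site.toComplex (u + ω j)) z < dist (Site.toComplex (u + ω t)) z) →
            s < dist (Site.toComplex (u + ω t)) z)),
          SAW.criticalFugacity ^ n) ≤ K₀ := by
  sorry

/-- **S2 · `stub_deathSeed`** — DEATH SEED (OPEN; HARDEST stub: the contraction per `A`-fold that carries `θ > 0`;
= triage r1-3's `DeathSeed`, r1-2's `ChainSeed`).  There are `A > 1` and `ε > 0` such that for every centre `z`, start
`u` and `N`, the chain-stopped mass at level `|u-z|/A` satisfies `D(u; |u-z|/A)[N] ≤ 1 - ε`: the radial renewal chain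
from `u` reaches its first renewal-or-end below `|u-z|/A` with total mass at most `1 - ε`.  Why plausibly true: by the
renewal structure `E[#renewal points in a fold] ≍ ρ^{3/4}` both from `u` (scale `R`) and from the landing point, and the
boundary-to-record two-point heuristics (`b = 5/8`, bulk `5/48`) give survival to scale `ρ` `≍ (ρ/R)^{35/48}`, i.e. a
limit `≈ A^{-35/48} < 1` per `A`-fold; exact enumeration: `D(u; R/2) = 0.427, 0.319, 0.366` (on-axis, `R = 2,3,4`) and
`0.45–0.51` (generic-centre corner starts, `R ≤ 3.9`) (triage r1-3 `radenum.c`); below the lattice scale (`|u-z|/A < 1/√2`)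
the family is "all walks `u → v*` in `D_{|u-z|}(z)`" for the lattice point `v*` nearest `z`, mass `≤ x_c + O(x_c³) ≈ 0.45`,
so `A` may be taken as large as convenient.  Why it might fail: needs a quantitative (< 1) uniform upper bound on a
critical `x_c`-mass uniformly in the scale — strictly more than S1; if the accumulated deficit `Σ (1 - k(v_j))` per fold
along the chain were ≤ 0 at large scales (Disproof §H shows `k > 1` pointwise at some generic configurations, `R ≈ 8`),
survival per fold would not contract and the statement would be false for every `A` in the scaling regime — the SLE
prediction says it contracts (exponent 35/48), the sign at accessible sizes is favourable (r1-1: `H` decays `0.94 → 0.25`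
over aspect 5.4).  Not an instance of any landed Negative lemma (endpoint clause kept; no decay in a radius `< 1` is
claimed: the bound is a constant). [DuminilCopinHammond2013 = arXiv:1205.0401 (renewal structure at `x_c`);
LawlerSchrammWerner2004SAW (exponents); MadrasSlade1993 §4.2] -/
theorem stub_deathSeed :
    ∃ A ε : ℝ, 1 < A ∧ 0 < ε ∧ ∀ (z : ℂ) (u : Site 2) (N : ℕ),
      (∑ n ∈ Finset.range (N + 1),
        ∑ _ω ∈ (SAW.Zd.saws 2 n).filter (fun ω =>
          0 < n ∧
          (∀ i, 0 < i → i ≤ n → dist (Site.toComplex (u + ω i)) z < dist (Site.toComplex u) z) ∧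
          (∀ i, i < n → dist (Site.toComplex (u + ω n)) z < dist (Site.toComplex (u + ω i)) z) ∧
          dist (Site.toComplex (u + ω n)) z ≤ dist (Site.toComplex u) z / A ∧
          (∀ t, 0 < t → t < n →
            (∀ i, i < t → dist (Site.toComplex (u + ω t)) z < dist (Site.toComplex (u + ω i)) z) →
            (∀ j, t < j → j ≤ n → dist (Site.toComplex (u + ω j)) z < dist (Site.toComplex (u + ω t)) z) →
            dist (Site.toComplex u) z / A < dist (Site.toComplex (u + ω t)) z)),
          SAW.criticalFugacity ^ n) ≤ 1 - ε := by
  sorry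

/-- **S3 · `stub_skipTail`** — SKIP TAIL OF THE FIRST `A`-DESCENT (OPEN; a one-arm / targeting estimate for a single
radially irreducible piece; the card's `RadialSkipTail` restricted as triage r1-1 required and phrased per `A`-descent as
r1-2 suggested).  For every `A > 1` there are `κ > 0` and `C` such that for all `B ≥ 1`, centres `z`, starts `u` with
`A·B ≤ |u-z|` and all `N`: the members of the level-`|u-z|/A` chain-stopped family whose END lies at level `≤ |u-z|/(AB)`
have `x_c`-mass `≤ C·B^{-κ}`.  (At `B = 1` this is boundedness of `D(u;|u-z|/A)`, implied by S2; the content is `B → ∞`: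
the irreducible piece that first crosses level `|u-z|/A` must END — at a strict radial record, with no renewal in between —
inside the disc of radius `|u-z|/(AB) ≥ 1`.)  Why plausibly true: macroscopic irreducible pieces per fold are `O(1)` in
number (span tail `ℓ^{-3/4}` × `ρ^{3/4}` renewals) and scale-free, and ENDING inside a disc `B` times smaller is a targeting
event, polynomially rare; exact data (r1-1): `0.13–0.32` at `B = 2`, `0.03–0.05` at `B = 4` across `R² = 5…17` and generic
centres.  The restriction `A·B ≤ |u-z|` (landing level ≥ 1) is NECESSARY: for `z` at distance `η → 0` from a lattice point
`v*` and `u = v* + (1,0)` the one-step walk `u → v*` is a member with `B = |u-z|/(Aη) → ∞` and mass `x_c`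
(cf. `annularMassDecay_false_without_innerRadiusOne`).  Why it might fail: it is an UPPER bound on a critical hitting
mass with a RATE — open on `ℤ²` like every polynomial statement here (the linear shadow, `P̄(L) → 0` for Kesten's
irreducible spans, is known only as `≤ 2/log L`); `κ` is predicted small but positive. [Kesten1963SAW; MadrasSlade1993
Thm 4.2.2 and (4.2.9)–(4.2.12); arXiv:1205.0401; arXiv:1305.1257] -/
theorem stub_skipTail :
    ∀ A : ℝ, 1 < A → ∃ κ C : ℝ, 0 < κ ∧ ∀ B : ℝ, 1 ≤ B → ∀ (z : ℂ) (u : Site 2),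
      A * B ≤ dist (Site.toComplex u) z → ∀ N : ℕ,
      (∑ n ∈ Finset.range (N + 1),
        ∑ _ω ∈ (SAW.Zd.saws 2 n).filter (fun ω =>
          dist (Site.toComplex (u + ω n)) z ≤ dist (Site.toComplex u) z / (A * B) ∧
          0 < n ∧
          (∀ i, 0 < i → i ≤ n → dist (Site.toComplex (u + ω i)) z < dist (Site.toComplex u) z) ∧
          (∀ i, i < n → dist (Site.toComplex (u + ω n)) z < dist (Site.toComplex (u + ω i)) z) ∧
          dist (Site.toComplex (u + ω n)) z ≤ dist (Site.toComplex u) z / A ∧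
          (∀ t, 0 < t → t < n →
            (∀ i, i < t → dist (Site.toComplex (u + ω t)) z < dist (Site.toComplex (u + ω i)) z) →
            (∀ j, t < j → j ≤ n → dist (Site.toComplex (u + ω j)) z < dist (Site.toComplex (u + ω t)) z) →
            dist (Site.toComplex u) z / A < dist (Site.toComplex (u + ω t)) z)),
          SAW.criticalFugacity ^ n) ≤ C * B ^ (-κ) := by
  sorry

/-- **S4 · `stub_firstDescentFactorisation`** — FIRST-`A`-DESCENT FACTORISATION (PROVABLE NOW, size M; the idea's lever
as a theorem).  For `A > 1`, centre `z`, start `u`, level `s < |u-z|/A` and `N`: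
`D(u;s)[N] ≤ Σ_{m ≤ N} Σ_{η} x_c^m · D(u + η m; s)[N] + Skip(u;A,s)[N]`, where `η` ranges over the level-`|u-z|/A`
members of length `m` whose end `w = u + η m` has `|w - z| > s`, `D(w;s)` is the level-`s` family FROM `w` (confined to
`D_{|w-z|}(z)`), and `Skip(u;A,s)` is the mass of level-`|u-z|/A` members ending at level `≤ s`.
Proof route (checked by hand here and by the three triagers for the one-level version): for a level-`s` member `ω` of
length `n` let `t*` be the least `t ∈ (0,n)` that is a radial renewal time with `|ω_t - z| ≤ |u-z|/A`, or `n` if none.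
If `t* = n`, `ω` itself is a level-`|u-z|/A` member ending at level `≤ s` (skip term).  If `t* < n`: the prefix
`i ↦ ω (min i t*)` is a level-`|u-z|/A` member (its end is a strict record because `t*` is a renewal; a renewal `t' < t*` of
the prefix at level `≤ |u-z|/A` would be one of `ω`, since after `t*` everything is closer than `ω_{t*}`, contradicting
minimality) with `|ω_{t*} - z| > s` (a renewal of `ω` before `n` has level `> s`); the suffix `i ↦ ω(t*+i) - ω(t*)` from
`w = u + ω t*` is a level-`s` member w.r.t. `w` (confined to `D_{|w-z|}` because `t*` is a renewal; its renewal times are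
exactly the renewal times of `ω` after `t*`); `(prefix, suffix)` determines `ω` (same split as `SAW.Zd.count_add_le`),
lengths `t* ≤ N`, `n - t* ≤ N`, weights multiply.  Summing the injection over nonnegative terms gives the inequality. -/
theorem stub_firstDescentFactorisation :
    ∀ A : ℝ, 1 < A → ∀ (z : ℂ) (u : Site 2) (s : ℝ), s < dist (Site.toComplex u) z / A → ∀ N : ℕ,
      (∑ n ∈ Finset.range (N + 1),
        ∑ _ω ∈ (SAW.Zd.saws 2 n).filter (fun ω =>
          0 < n ∧
          (∀ i, 0 < i → i ≤ n → dist (Site.toComplex (u + ω i)) z < dist (Site.toComplex u) z) ∧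
          (∀ i, i < n → dist (Site.toComplex (u + ω n)) z < dist (Site.toComplex (u + ω i)) z) ∧
          dist (Site.toComplex (u + ω n)) z ≤ s ∧
          (∀ t, 0 < t → t < n →
            (∀ i, i < t → dist (Site.toComplex (u + ω t)) z < dist (Site.toComplex (u + ω i)) z) →
            (∀ j, t < j → j ≤ n → dist (Site.toComplex (u + ω j)) z < dist (Site.toComplex (u + ω t)) z) →
            s < dist (Site.toComplex (u + ω t)) z)),
          SAW.criticalFugacity ^ n) ≤
      (∑ m ∈ Finset.range (N + 1),
        ∑ η ∈ (SAW.Zd.saws 2 m).filter (fun η =>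
            s < dist (Site.toComplex (u + η m)) z ∧
            0 < m ∧
            (∀ i, 0 < i → i ≤ m → dist (Site.toComplex (u + η i)) z < dist (Site.toComplex u) z) ∧
            (∀ i, i < m → dist (Site.toComplex (u + η m)) z < dist (Site.toComplex (u + η i)) z) ∧
            dist (Site.toComplex (u + η m)) z ≤ dist (Site.toComplex u) z / A ∧
            (∀ t, 0 < t → t < m →
              (∀ i, i < t → dist (Site.toComplex (u + η t)) z < dist (Site.toComplex (u + η i)) z) →
              (∀ j, t < j → j ≤ m → dist (Site.toComplex (u + η j)) z < dist (Site.toComplex (u + η t)) z) →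
              dist (Site.toComplex u) z / A < dist (Site.toComplex (u + η t)) z)),
          SAW.criticalFugacity ^ m *
            (∑ n ∈ Finset.range (N + 1),
                ∑ _ω ∈ (SAW.Zd.saws 2 n).filter (fun ω =>
                  0 < n ∧
                  (∀ i, 0 < i → i ≤ n → dist (Site.toComplex (u + η m + ω i)) z < dist (Site.toComplex (u + η m)) z) ∧
                  (∀ i, i < n → dist (Site.toComplex (u + η m + ω n)) z < dist (Site.toComplex (u + η m + ω i)) z) ∧
                  dist (Site.toComplex (u + η m + ω n)) z ≤ s ∧
                  (∀ t, 0 < t → t < n →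
                    (∀ i, i < t → dist (Site.toComplex (u + η m + ω t)) z < dist (Site.toComplex (u + η m + ω i)) z) →
                    (∀ j, t < j → j ≤ n → dist (Site.toComplex (u + η m + ω j)) z < dist (Site.toComplex (u + η m + ω t)) z) →
                    s < dist (Site.toComplex (u + η m + ω t)) z)),
                  SAW.criticalFugacity ^ n)) +
      (∑ n ∈ Finset.range (N + 1),
        ∑ _ω ∈ (SAW.Zd.saws 2 n).filter (fun ω =>
          dist (Site.toComplex (u + ω n)) z ≤ s ∧
          0 < n ∧
          (∀ i, 0 < i → i ≤ n → dist (Site.toComplex (u + ω i)) z < dist (Site.toComplex u) z) ∧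
          (∀ i, i < n → dist (Site.toComplex (u + ω n)) z < dist (Site.toComplex (u + ω i)) z) ∧
          dist (Site.toComplex (u + ω n)) z ≤ dist (Site.toComplex u) z / A ∧
          (∀ t, 0 < t → t < n →
            (∀ i, i < t → dist (Site.toComplex (u + ω t)) z < dist (Site.toComplex (u + ω i)) z) →
            (∀ j, t < j → j ≤ n → dist (Site.toComplex (u + ω j)) z < dist (Site.toComplex (u + ω t)) z) →
            dist (Site.toComplex u) z / A < dist (Site.toComplex (u + ω t)) z)),
          SAW.criticalFugacity ^ n) := by
  sorry

/-- **S5 · `stub_chainDecay`** — RENEWAL-INEQUALITY INDUCTION (PROVABLE NOW, size M–L; pure real analysis on S4's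
inequality): S4 → S1 → S2 → S3 → `ChainDecay` (`∃ θ > 0, C` with `D(u;r)[N] ≤ C (r/|u-z|)^θ` for `1 ≤ r < |u-z|`).
Proof route: fix `A, ε` (S2), `κ, C_s` (S3 at this `A`), `K₀` (S1).  Classify a pair (start, level) by `j = 0` if
`|u-z|/s ≤ A`, else the `j ≥ 1` with `A^j < |u-z|/s ≤ A^{j+1}`; prove by strong induction on `j` that `D(u;s)[N] ≤ K λ^j`
for all `z, u, N` and `s ≥ 1` in class `j`, for suitable `λ ∈ [A^{-κ/2}, 1)` and `K ≥ max(K₀, 1)`.  Class 0: S1.  Class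
`j ≥ 1` (so `s < |u-z|/A`): apply S4; the skip term is S3 with `B = |u-z|/(As)` (`1 ≤ B`, `A·B = |u-z|/s ≤ |u-z|` as
`s ≥ 1`): `≤ C_s A^κ A^{-κ j} ≤ C_s A^κ λ^{2j}`; in the main term a prefix `η` landing at `w`, `s < |w-z| ≤ |u-z|/A`, has
overshoot `b_η = |u-z|/(A|w-z|) ≥ 1` and `(w,s)` in a class `j'` with `j - 2 - log_A b_η < j' < j`, so by induction
`D(w;s) ≤ K λ^{j-2} b_η^{θ'}`, `θ' = log_A(1/λ)`; band the prefixes by `b_η ∈ [A^i, A^{i+1})`: band masses `m_i` have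
`Σ_i m_i ≤ 1 - ε` (S2) and `m_i ≤ C_s A^{-κ i}` (S3 with `B = A^i ≤ |u-z|/(As)`), whence
`Σ_η x_c^{|η|} b_η^{θ'} ≤ λ^{-(i₀+1)}(1-ε) + Σ_{i>i₀} λ^{-(i+1)} C_s A^{-κ i}`; choose `i₀` (tail `≤ ε/8`, uniformly for
`λ ≥ A^{-κ/2}`), then `λ` close to `1` (`(1-ε)λ^{-(i₀+3)} ≤ 1 - ε/2`), then `K ≥ 8 C_s A^κ/(3ε)`: total `≤ K λ^j`.
Finally `λ^j ≤ A^{θ'} (r/|u-z|)^{θ'}` in class `j`, so `θ = θ'`, `C = K A^{θ'}`.  Only finite sums occur (lengths ≤ N,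
finitely many prefixes), so the banding is a finite regrouping. [Feller XIII-type renewal inequality; MadrasSlade1993 App. A] -/
theorem stub_chainDecay :
    (∀ A : ℝ, 1 < A → ∀ (z : ℂ) (u : Site 2) (s : ℝ), s < dist (Site.toComplex u) z / A → ∀ N : ℕ,
      (∑ n ∈ Finset.range (N + 1),
        ∑ _ω ∈ (SAW.Zd.saws 2 n).filter (fun ω =>
          0 < n ∧
          (∀ i, 0 < i → i ≤ n → dist (Site.toComplex (u + ω i)) z < dist (Site.toComplex u) z) ∧
          (∀ i, i < n → dist (Site.toComplex (u + ω n)) z < dist (Site.toComplex (u + ω i)) z) ∧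
          dist (Site.toComplex (u + ω n)) z ≤ s ∧
          (∀ t, 0 < t → t < n →
            (∀ i, i < t → dist (Site.toComplex (u + ω t)) z < dist (Site.toComplex (u + ω i)) z) →
            (∀ j, t < j → j ≤ n → dist (Site.toComplex (u + ω j)) z < dist (Site.toComplex (u + ω t)) z) →
            s < dist (Site.toComplex (u + ω t)) z)),
          SAW.criticalFugacity ^ n) ≤
      (∑ m ∈ Finset.range (N + 1),
        ∑ η ∈ (SAW.Zd.saws 2 m).filter (fun η =>
            s < dist (Site.toComplex (u + η m)) z ∧
            0 < m ∧
            (∀ i, 0 < i → i ≤ m → dist (Site.toComplex (u + η i)) z < dist (Site.toComplex u) z) ∧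
            (∀ i, i < m → dist (Site.toComplex (u + η m)) z < dist (Site.toComplex (u + η i)) z) ∧
            dist (Site.toComplex (u + η m)) z ≤ dist (Site.toComplex u) z / A ∧
            (∀ t, 0 < t → t < m →
              (∀ i, i < t → dist (Site.toComplex (u + η t)) z < dist (Site.toComplex (u + η i)) z) →
              (∀ j, t < j → j ≤ m → dist (Site.toComplex (u + η j)) z < dist (Site.toComplex (u + η t)) z) →
              dist (Site.toComplex u) z / A < dist (Site.toComplex (u + η t)) z)),
          SAW.criticalFugacity ^ m *
            (∑ n ∈ Finset.range (N + 1),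
                ∑ _ω ∈ (SAW.Zd.saws 2 n).filter (fun ω =>
                  0 < n ∧
                  (∀ i, 0 < i → i ≤ n → dist (Site.toComplex (u + η m + ω i)) z < dist (Site.toComplex (u + η m)) z) ∧
                  (∀ i, i < n → dist (Site.toComplex (u + η m + ω n)) z < dist (Site.toComplex (u + η m + ω i)) z) ∧
                  dist (Site.toComplex (u + η m + ω n)) z ≤ s ∧
                  (∀ t, 0 < t → t < n →
                    (∀ i, i < t → dist (Site.toComplex (u + η m + ω t)) z < dist (Site.toComplex (u + η m + ω i)) z) →
                    (∀ j, t < j → j ≤ n → dist (Site.toComplex (u + η m + ω j)) z < dist (Site.toComplex (u + η m + ω t)) z) →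
                    s < dist (Site.toComplex (u + η m + ω t)) z)),
                  SAW.criticalFugacity ^ n)) +
      (∑ n ∈ Finset.range (N + 1),
        ∑ _ω ∈ (SAW.Zd.saws 2 n).filter (fun ω =>
          dist (Site.toComplex (u + ω n)) z ≤ s ∧
          0 < n ∧
          (∀ i, 0 < i → i ≤ n → dist (Site.toComplex (u + ω i)) z < dist (Site.toComplex u) z) ∧
          (∀ i, i < n → dist (Site.toComplex (u + ω n)) z < dist (Site.toComplex (u + ω i)) z) ∧
          dist (Site.toComplex (u + ω n)) z ≤ dist (Site.toComplex u) z / A ∧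
          (∀ t, 0 < t → t < n →
            (∀ i, i < t → dist (Site.toComplex (u + ω t)) z < dist (Site.toComplex (u + ω i)) z) →
            (∀ j, t < j → j ≤ n → dist (Site.toComplex (u + ω j)) z < dist (Site.toComplex (u + ω t)) z) →
            dist (Site.toComplex u) z / A < dist (Site.toComplex (u + ω t)) z)),
          SAW.criticalFugacity ^ n)) →
    (∃ K₀ : ℝ, ∀ (z : ℂ) (u : Site 2) (s : ℝ), 1 ≤ s → ∀ N : ℕ,
      (∑ n ∈ Finset.range (N + 1),
        ∑ _ω ∈ (SAW.Zd.saws 2 n).filter (fun ω =>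
          0 < n ∧
          (∀ i, 0 < i → i ≤ n → dist (Site.toComplex (u + ω i)) z < dist (Site.toComplex u) z) ∧
          (∀ i, i < n → dist (Site.toComplex (u + ω n)) z < dist (Site.toComplex (u + ω i)) z) ∧
          dist (Site.toComplex (u + ω n)) z ≤ s ∧
          (∀ t, 0 < t → t < n →
            (∀ i, i < t → dist (Site.toComplex (u + ω t)) z < dist (Site.toComplex (u + ω i)) z) →
            (∀ j, t < j → j ≤ n → dist (Site.toComplex (u + ω j)) z < dist (Site.toComplex (u + ω t)) z) →
            s < dist (Site.toComplex (u + ω t)) z)),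
          SAW.criticalFugacity ^ n) ≤ K₀) →
    (∃ A ε : ℝ, 1 < A ∧ 0 < ε ∧ ∀ (z : ℂ) (u : Site 2) (N : ℕ),
      (∑ n ∈ Finset.range (N + 1),
        ∑ _ω ∈ (SAW.Zd.saws 2 n).filter (fun ω =>
          0 < n ∧
          (∀ i, 0 < i → i ≤ n → dist (Site.toComplex (u + ω i)) z < dist (Site.toComplex u) z) ∧
          (∀ i, i < n → dist (Site.toComplex (u + ω n)) z < dist (Site.toComplex (u + ω i)) z) ∧
          dist (Site.toComplex (u + ω n)) z ≤ dist (Site.toComplex u) z / A ∧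
          (∀ t, 0 < t → t < n →
            (∀ i, i < t → dist (Site.toComplex (u + ω t)) z < dist (Site.toComplex (u + ω i)) z) →
            (∀ j, t < j → j ≤ n → dist (Site.toComplex (u + ω j)) z < dist (Site.toComplex (u + ω t)) z) →
            dist (Site.toComplex u) z / A < dist (Site.toComplex (u + ω t)) z)),
          SAW.criticalFugacity ^ n) ≤ 1 - ε) →
    (∀ A : ℝ, 1 < A → ∃ κ C : ℝ, 0 < κ ∧ ∀ B : ℝ, 1 ≤ B → ∀ (z : ℂ) (u : Site 2),
      A * B ≤ dist (Site.toComplex u) z → ∀ N : ℕ,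
      (∑ n ∈ Finset.range (N + 1),
        ∑ _ω ∈ (SAW.Zd.saws 2 n).filter (fun ω =>
          dist (Site.toComplex (u + ω n)) z ≤ dist (Site.toComplex u) z / (A * B) ∧
          0 < n ∧
          (∀ i, 0 < i → i ≤ n → dist (Site.toComplex (u + ω i)) z < dist (Site.toComplex u) z) ∧
          (∀ i, i < n → dist (Site.toComplex (u + ω n)) z < dist (Site.toComplex (u + ω i)) z) ∧
          dist (Site.toComplex (u + ω n)) z ≤ dist (Site.toComplex u) z / A ∧
          (∀ t, 0 < t → t < n →
            (∀ i, i < t → dist (Site.toComplex (u + ω t)) z < dist (Site.toComplex (u + ω i)) z) →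
            (∀ j, t < j → j ≤ n → dist (Site.toComplex (u + ω j)) z < dist (Site.toComplex (u + ω t)) z) →
            dist (Site.toComplex u) z / A < dist (Site.toComplex (u + ω t)) z)),
          SAW.criticalFugacity ^ n) ≤ C * B ^ (-κ)) →
    ∃ θ C : ℝ, 0 < θ ∧ ∀ (z : ℂ) (u : Site 2) (r : ℝ), 1 ≤ r → r < dist (Site.toComplex u) z → ∀ N : ℕ,
      (∑ n ∈ Finset.range (N + 1),
        ∑ _ω ∈ (SAW.Zd.saws 2 n).filter (fun ω =>
          0 < n ∧
          (∀ i, 0 < i → i ≤ n → dist (Site.toComplex (u + ω i)) z < dist (Site.toComplex u) z) ∧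
          (∀ i, i < n → dist (Site.toComplex (u + ω n)) z < dist (Site.toComplex (u + ω i)) z) ∧
          dist (Site.toComplex (u + ω n)) z ≤ r ∧
          (∀ t, 0 < t → t < n →
            (∀ i, i < t → dist (Site.toComplex (u + ω t)) z < dist (Site.toComplex (u + ω i)) z) →
            (∀ j, t < j → j ≤ n → dist (Site.toComplex (u + ω j)) z < dist (Site.toComplex (u + ω t)) z) →
            r < dist (Site.toComplex (u + ω t)) z)),
          SAW.criticalFugacity ^ n) ≤ C * (r / dist (Site.toComplex u) z) ^ θ := by
  sorry

/-! ### Consistency: each named statement IS its registered stub (definitionally) -/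

theorem chainBounded_holds : ChainBounded := stub_chainBounded
theorem deathSeed_holds : DeathSeed := stub_deathSeed
theorem skipTail_holds : SkipTail := stub_skipTail
theorem firstDescentFactorisation_holds : FirstDescentFactorisation := stub_firstDescentFactorisation
theorem chainDecayReduction_holds : ChainDecayReduction := stub_chainDecay

/-! ### Name-keyed aliases of the five statements (the hypotheses of the composition) -/
namespace Registered

/-- Alias of `ChainBounded` keyed by the registered stub name. -/
abbrev stub_chainBounded : Prop := ChainBounded
/-- Alias of `DeathSeed` keyed by the registered stub name. -/
abbrev stub_deathSeed : Prop := DeathSeed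
/-- Alias of `SkipTail` keyed by the registered stub name. -/
abbrev stub_skipTail : Prop := SkipTail
/-- Alias of `FirstDescentFactorisation` keyed by the registered stub name. -/
abbrev stub_firstDescentFactorisation : Prop := FirstDescentFactorisation
/-- Alias of `ChainDecayReduction` keyed by the registered stub name. -/
abbrev stub_chainDecay : Prop := ChainDecayReduction

end Registered

/-! ## The composition: the five stubs imply the crux, BY NAME (kernel-checked; no `sorry` below) -/

/-- **`AnnularMassDecay_of`** — S4, S1, S2, S3 feed S5 to give `ChainDecay`; an annular bridge of the crux (interior in
`r < |·-z| < R`, end in `|·-z| ≤ r`, start with `R ≤ |u-z|`, `1 ≤ r < R`) is a member of the level-`r` chain-stopped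
family of `u` (it has `n > 0`; it is confined to `D_R ⊆ D_{|u-z|}`; its end is a strict radial record; every interior
time, renewal or not, has level `> r`), so the crux's double sum is `≤ D(u;r)[N] ≤ C (r/|u-z|)^θ ≤ max C 0 · (r/R)^θ`. -/
theorem AnnularMassDecay_of (h₁ : Registered.stub_chainBounded) (h₂ : Registered.stub_deathSeed)
    (h₃ : Registered.stub_skipTail) (h₄ : Registered.stub_firstDescentFactorisation)
    (h₅ : Registered.stub_chainDecay) : AnnularMassDecay := by
  have hdec : ChainDecay := h₅ h₄ h₁ h₂ h₃
  obtain ⟨θ, C, hθ, hD⟩ := hdec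
  refine ⟨θ, max C 0, hθ, fun z r R hr hrR u hRu N => ?_⟩
  have hRpos : 0 < R := by linarith
  have hrρ : r < dist (Site.toComplex u) z := lt_of_lt_of_le hrR hRu
  have key := hD z u r hr hrρ N
  refine le_trans ?_ (key.trans ?_)
  · -- the crux family is a sub-family of the level-`r` chain-stopped family of `u`
    refine Finset.sum_le_sum fun n _ => ?_
    refine Finset.sum_le_sum_of_subset_of_nonneg ?_ fun _ _ _ => pow_nonneg criticalFugacity_pos.le _
    intro ω hω
    rw [Finset.mem_filter] at hω ⊢
    obtain ⟨hωs, hint, hend⟩ := hω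
    have h0 : ω 0 = 0 := (SAW.Zd.mem_saws.1 hωs).1
    have hd0 : dist (Site.toComplex (u + ω 0)) z = dist (Site.toComplex u) z := by rw [h0, add_zero]
    refine ⟨hωs, ?_, ?_, ?_, hend, ?_⟩
    · rcases Nat.eq_zero_or_pos n with hn | hn
      · exfalso
        subst hn
        rw [hd0] at hend
        linarith
      · exact hn
    · intro i hi0 hin
      rcases hin.lt_or_eq with hlt | heq
      · exact (hint i hi0 hlt).2.trans_le hRu
      · rw [heq]
        exact lt_of_le_of_lt hend hrρ
    · intro i hin
      rcases Nat.eq_zero_or_pos i with hi0 | hi0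
      · subst hi0
        rw [hd0]
        exact lt_of_le_of_lt hend hrρ
      · exact lt_of_le_of_lt hend (hint i hi0 hin).1
    · intro t ht0 htn _ _
      exact (hint t ht0 htn).1
  · -- `C (r/|u-z|)^θ ≤ max C 0 · (r/R)^θ`
    have hq0 : 0 ≤ r / dist (Site.toComplex u) z := div_nonneg (by linarith) (by linarith)
    calc C * (r / dist (Site.toComplex u) z) ^ θ ≤ max C 0 * (r / dist (Site.toComplex u) z) ^ θ :=
          mul_le_mul_of_nonneg_right (le_max_left _ _) (Real.rpow_nonneg hq0 θ)
      _ ≤ max C 0 * (r / R) ^ θ :=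
          mul_le_mul_of_nonneg_left
            (Real.rpow_le_rpow hq0 (div_le_div_of_nonneg_left (by linarith) hRpos hRu) hθ.le)
            (le_max_right _ _)

/-- Wiring check: the registered stubs feed `AnnularMassDecay_of` as stated (the verbatim restatements are
definitionally the named statements). -/
example : AnnularMassDecay :=
  AnnularMassDecay_of stub_chainBounded stub_deathSeed stub_skipTail stub_firstDescentFactorisation
    stub_chainDecay

end Summit.CriticalPhenomena.SAWScalingLimit.Cruxes.AnnularMassDecay.RadialRenewalKestenInequality

end
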